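import Mathlib
import Literature.AlgebraicGeometry.Resolution.CobordantGame
import Literature.AlgebraicGeometry.Resolution.CobordantArcLemma
import Literature.AlgebraicGeometry.Resolution.FormalCoordinateChange
import Literature.AlgebraicGeometry.Resolution.NodalFamilyRingDomain
import Summits.ResolutionOfSingularities.ResolutionOfSingularities.Theorems.WeightedInvariantGlobalizeLocalDropCanonize
import Summits.ResolutionOfSingularities.ResolutionOfSingularities.Theorems.WeightedInvariantGlobalizeLocalDropCylinder
import Summits.ResolutionOfSingularities.ResolutionOfSingularities.Theorems.WeightedInvariantLocalWeightedDropWildPurePowerDescentTwo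
import Summits.ResolutionOfSingularities.ResolutionOfSingularities.Theorems.WeightedInvariantLocalWeightedDropWildTerminalCalculus
import Summits.ResolutionOfSingularities.ResolutionOfSingularities.Theorems.WeightedInvariantLocalWeightedDropUnaryConeForm
import Summits.ResolutionOfSingularities.ResolutionOfSingularities.Theorems.WeightedInvariantLocalWeightedDropWeierstrassForm
import Summits.ResolutionOfSingularities.ResolutionOfSingularities.Theorems.WeightedInvariantLocalWeightedDropMonicRecentre

/-!
# `WeightedInvariant.LocalWeightedDrop`: the local weighted resolution game REDUCES TO THE REDUCED GERM — a germ is won as soon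
# as the product of its distinct factors is won (`Won (∏ Qᵢ) → Won (U · ∏ Qᵢ^{mᵢ})`)

Crux item stmt-ResolutionOfSingularities-8899 `LocalWeightedDrop` (route `ResolutionOfSingularities/WeightedInvariant`), engine of
the door `HypersurfaceCentreConstruction` stmt-ResolutionOfSingularities-19897.  [OURS · L1 W4.3, chain w43, res-type-083 (extra
seat S3ρ): game-level tool recorded for the S3ρ line — the registered pieces (S3ρ, S3πM, …) quantify over ALL germs of their
class, non-reduced ones included (e.g. `(y² + x₁³)³` is a monic position of degree `6`), while the printed invariants (Perlega
2017/2020, CJS LNM 2270) are stated for reduced surfaces.  Not a statement of any manuscript.]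

* `won_unit_mul_pow_of_linear`: a power `U · g^m` of a SMOOTH germ (`g(0) = 0`, some linear coefficient `≠ 0`, `U` a unit) is won:
  straighten `g` to `y` (linear change + Weierstrass preparation in degree `1` + a re-centring), then the divisor move on `y`
  (`WildPurePower.won_X_pow_last`).
* `won_unit_mul_prod_pow`: if `∏ᵢ Qᵢ` is won then so is `U · ∏ᵢ Qᵢ^{mᵢ}` for every unit `U` and all `mᵢ ≥ 1` — by induction
  on the winning derivation: the SAME moves work, because the `s`-saturated successors of `U ∏ Qᵢ^{mᵢ}` are
  `U' ∏ gᵢ^{mᵢ}` for the saturated successor `∏ gᵢ` of `∏ Qᵢ` (the variable `s` is prime, `MvPowerSeries.prime_X'`;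
  `X_pow_mul_eq_X_pow_mul`); when `∏ gᵢ` stops being singular, at most one `gᵢ` is a non-unit and it is smooth, so
  `won_unit_mul_pow_of_linear` finishes.
Consequence for the lines: a NON-REDUCED germ whose reduction has smaller order is won from the hypothesis on germs of smaller
order — the descent data of S3ρ / S3πM may exit on non-reduced positions.
-/

set_option linter.dupNamespace false -- mandated namespace of this single-conjunct summit

namespace Summit.ResolutionOfSingularities.ResolutionOfSingularities.Theorems

open Literature.AlgebraicGeometry.Resolution
open Literature.AlgebraicGeometry.Resolution.CobordantGame

namespace WonMultiplicity

open MvPowerSeries WildTerminal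

variable {k : Type} [Field k]

/-! ### Powers of a smooth germ -/

/-- A POWER OF A SMOOTH GERM TIMES A UNIT IS WON (`n + 1 ≥ 1` variables): `g(0) = 0`, some linear coefficient of `g` is
non-zero, `U(0) ≠ 0` ⇒ `Won (U · g^m)`. -/
theorem won_unit_mul_pow_of_linear {n : ℕ} (g U : MvPowerSeries (Fin (n + 1)) k) (hg0 : constantCoeff g = 0)
    (hlin : ∃ j, coeff (Finsupp.single j 1) g ≠ 0) (hU : constantCoeff U ≠ 0) (m : ℕ) :
    CobordantGame.Won k (n + 1) (U * g ^ m) := by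
  classical
  -- straighten the linear part of `g` to `y = X (Fin.last n)`
  set ℓ : Fin (n + 1) → k := fun j => coeff (Finsupp.single j 1) g with hℓ
  have hℓne : ℓ ≠ 0 := by
    obtain ⟨j, hj⟩ := hlin
    exact fun h => hj (congr_fun h j)
  obtain ⟨M, hMdet, hℓM⟩ := UnaryConeForm.exists_matrix_vecMul_eq ℓ hℓne
  set g' := subst (FormalCoordChange.linSubst M) g with hg'
  have hg'0 : constantCoeff g' = 0 := by
    rw [hg', WildTerminal.constantCoeff_subst_of_constantCoeff_zero (ConeDichotomy.constantCoeff_linSubst M), hg0]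
  have hg'1 : coeff (Finsupp.single (Fin.last n) 1) g' = 1 := by
    rw [hg', CobordantArc.coeff_degree_one_subst _ (ConeDichotomy.constantCoeff_linSubst M) g _ (Finsupp.degree_single _ _)]
    have h := congr_fun hℓM (Fin.last n)
    rw [Matrix.vecMul, dotProduct, Pi.single_eq_same] at h
    rw [← h]
    refine Finset.sum_congr rfl fun l _ => ?_
    rw [hℓ]
    congr 1
    have := congr_fun (congr_fun (ConeDichotomy.linMat_linSubst (k := k) M) l) (Fin.last n)
    rw [Matrix.of_apply] at this
    exact this
  -- Weierstrass preparation in degree `1`: `g' = H · (y + A₀)`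
  obtain ⟨H, A, hH, hA0, hgeq⟩ := WeierstrassForm.exists_weierstrass (d := 1) g'
    (fun n' hn' => by
      have h0 : n' = 0 := by omega
      subst h0
      rw [Finsupp.single_zero, coeff_zero_eq_constantCoeff_apply]
      exact hg'0)
    (by rw [hg'1]; exact one_ne_zero)
  have hgeq' : g' = H * (X (Fin.last n) + rename (Fin.succAboveEmb (Fin.last n)) (A 0)) := by
    rw [hgeq, Fin.sum_univ_one, pow_one, Fin.val_zero, pow_zero, mul_one]
  -- the re-centring `y ↦ y - A₀`
  set φ : MvPowerSeries (Fin n) k := -A 0 with hφ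
  have hφ0 : constantCoeff φ = 0 := by rw [hφ, map_neg, hA0, neg_zero]
  obtain ⟨τ, hτ⟩ : ∃ τ : Fin (n + 1) → MvPowerSeries (Fin (n + 1)) k,
      ∀ l, τ l = if l = Fin.last n then X (Fin.last n) + rename (Fin.succAboveEmb (Fin.last n)) φ else X l :=
    ⟨_, fun _ => rfl⟩
  have hτeq : τ = fun l : Fin (n + 1) => if l = Fin.last n
      then X (Fin.last n) + rename (Fin.succAboveEmb (Fin.last n)) φ else X l := funext hτ
  have hτ0 : ∀ l, constantCoeff (τ l) = 0 := by
    intro l; rw [hτ]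
    split_ifs
    · rw [map_add, constantCoeff_X, constantCoeff_rename, hφ0, add_zero]
    · exact constantCoeff_X l
  have hτs := hasSubst_of_constantCoeff_zero hτ0
  have hτdet : IsUnit (FormalCoordChange.linMat τ).det := by
    have hc1 : coeff (Finsupp.single (Fin.last n) 1) (rename (Fin.succAboveEmb (Fin.last n)) φ) = 0 := by
      have h := TschirnhausForm.coeff_emb_add_single_rename (m := n) (0 : Fin n →₀ ℕ) 1 φ
      rw [Finsupp.embDomain_zero, zero_add, if_neg one_ne_zero] at h
      exact h
    rw [FormalCoordChange.linMat, TschirnhausForm.det_of_offLast_rows]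
    · rw [Matrix.of_apply, hτ, if_pos rfl, map_add, coeff_index_single_self_X, hc1, add_zero]
      exact isUnit_one
    · intro l j hl
      rw [Matrix.of_apply, hτ, if_neg hl, coeff_index_single_X]
  have hτy : subst τ (X (Fin.last n) + rename (Fin.succAboveEmb (Fin.last n)) (A 0)) = X (Fin.last n) := by
    rw [← coe_substAlgHom hτs, map_add, coe_substAlgHom, subst_X hτs, hτ, if_pos rfl, hτeq,
      MonicRecentre.subst_shear_rename φ hφ0, hφ, map_neg, neg_add_cancel_right]
  -- transport: `Won (U g^m) ↔ Won ((U g^m) ∘ M) ↔ Won ((U g^m) ∘ M ∘ τ) = Won (unit · y^m)`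
  have hMs := FormalCoordChange.hasSubst_linSubst (k := k) M
  rw [← won_subst_iff (ConeDichotomy.constantCoeff_linSubst M)
    (by rw [CharTwoDoublePoint.linMat_linSubst]; exact hMdet), ← won_subst_iff hτ0 hτdet]
  have hform : subst τ (subst (FormalCoordChange.linSubst M) (U * g ^ m)) =
      (subst τ (subst (FormalCoordChange.linSubst M) U) * (subst τ H) ^ m) * X (Fin.last n) ^ m := by
    rw [← coe_substAlgHom hMs, map_mul, map_pow, coe_substAlgHom, ← hg', hgeq', ← coe_substAlgHom hτs, map_mul, map_pow,
      map_mul, coe_substAlgHom, hτy]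
    ring
  rw [hform]
  refine (won_unit_mul_iff ?_ _).mpr (WildPurePower.won_X_pow_last n m)
  rw [map_mul, map_pow, WildTerminal.constantCoeff_subst_of_constantCoeff_zero hτ0,
    WildTerminal.constantCoeff_subst_of_constantCoeff_zero (ConeDichotomy.constantCoeff_linSubst M),
    WildTerminal.constantCoeff_subst_of_constantCoeff_zero hτ0]
  exact mul_ne_zero hU (pow_ne_zero _ hH)

/-! ### Products with multiplicities -/

/-- A product of germs two of which lie in `𝔪` has no linear terms. -/
theorem coeff_single_one_prod_eq_zero {σ : Type} [Fintype σ] {r : ℕ} (g : Fin r → MvPowerSeries σ k) {i₁ i₂ : Fin r}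
    (hne : i₁ ≠ i₂) (h₁ : constantCoeff (g i₁) = 0) (h₂ : constantCoeff (g i₂) = 0) (j : σ) :
    coeff (Finsupp.single j 1) (∏ i, g i) = 0 := by
  classical
  apply coeff_of_lt_order
  rw [Finsupp.degree_single, ← Finset.mul_prod_erase _ _ (Finset.mem_univ i₁),
    ← Finset.mul_prod_erase _ _ (Finset.mem_erase.mpr ⟨hne.symm, Finset.mem_univ i₂⟩), ← mul_assoc]
  have h1 : (1 : ℕ∞) ≤ (g i₁).order := one_le_order_iff_constCoeff_eq_zero.mpr h₁
  have h2 : (1 : ℕ∞) ≤ (g i₂).order := one_le_order_iff_constCoeff_eq_zero.mpr h₂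
  calc ((1 : ℕ) : ℕ∞) < 1 + 1 := by norm_num
    _ ≤ (g i₁).order + (g i₂).order := add_le_add h1 h2
    _ ≤ (g i₁ * g i₂).order := le_order_mul
    _ ≤ (g i₁ * g i₂).order + (((Finset.univ.erase i₁).erase i₂).prod g).order := le_self_add
    _ ≤ _ := le_order_mul

/-- **THE GAME REDUCES TO THE REDUCED GERM**: if `∏ᵢ Qᵢ` is won, then `U · ∏ᵢ Qᵢ^{mᵢ}` is won for every unit `U` and all
exponents `mᵢ ≥ 1`. -/
theorem won_unit_mul_prod_pow {n : ℕ} {F : MvPowerSeries (Fin n) k} (hF : CobordantGame.Won k n F) :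
    ∀ {r : ℕ} (Q : Fin r → MvPowerSeries (Fin n) k) (m : Fin r → ℕ) (U : MvPowerSeries (Fin n) k),
      (∀ i, 1 ≤ m i) → constantCoeff U ≠ 0 → F = ∏ i, Q i → CobordantGame.Won k n (U * ∏ i, Q i ^ m i) := by
  classical
  induction hF with
  | move θ w hm h ih =>
  rename_i n F
  intro r Q m U hm1 hU hFQ
  refine Won.move θ w hm fun g' hg' => ?_
  obtain ⟨c, a', hc, hfac, hndvd, hsing⟩ := hg'
  -- the transform `T = chart ∘ θ` is a ring map keeping constant coefficients
  have hθ0 : ∀ i, constantCoeff (θ i) = 0 := hm.1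
  have hθs : HasSubst θ := hasSubst_of_constantCoeff_zero hθ0
  have hc0 : ∀ i, constantCoeff (cruxChart k w c i) = 0 := constantCoeff_cruxChart w c
  have hcs : HasSubst (cruxChart k w c) := hasSubst_of_constantCoeff_zero hc0
  set T : MvPowerSeries (Fin n) k →ₐ[k] MvPowerSeries (Fin (n + 1)) k :=
    (substAlgHom hcs).comp (substAlgHom hθs) with hTdef
  have hT : ∀ f, subst (cruxChart k w c) (subst θ f) = T f := fun f => by
    rw [hTdef, AlgHom.comp_apply, coe_substAlgHom, coe_substAlgHom]
  have hTc : ∀ f, constantCoeff (T f) = constantCoeff f := fun f => by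
    rw [← hT, WildTerminal.constantCoeff_subst_of_constantCoeff_zero hc0, WildTerminal.constantCoeff_subst_of_constantCoeff_zero hθ0]
  rw [hT] at hfac
  -- the factors' transforms are non-zero: saturate them
  have hg'ne : g' ≠ 0 := fun h0 => hndvd (by rw [h0]; exact dvd_zero _)
  have hprodne : T U * ∏ i, T (Q i) ^ m i ≠ 0 := by
    have : T (U * ∏ i, Q i ^ m i) ≠ 0 := by
      rw [hfac]; exact mul_ne_zero (pow_ne_zero _ (X_ne_zero' 0)) hg'ne
    rwa [map_mul, map_prod, funext fun i => map_pow T (Q i) (m i)] at this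
  have hQne : ∀ i, T (Q i) ≠ 0 := fun i h0 => by
    apply hprodne
    rw [Finset.prod_eq_zero (Finset.mem_univ i) (by rw [h0, zero_pow (by have := hm1 i; omega)]), mul_zero]
  choose a g hQfac hgndvd using fun i => exists_eq_X_pow_mul_not_dvd (0 : Fin (n + 1)) (hQne i)
  have hprime : Prime (X 0 : MvPowerSeries (Fin (n + 1)) k) := MvPowerSeries.prime_X' k 0
  -- the transform of `G = U ∏ Q^m`
  have hG : T (U * ∏ i, Q i ^ m i) = X 0 ^ (∑ i, m i * a i) * (T U * ∏ i, g i ^ m i) := by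
    rw [map_mul, map_prod]
    simp_rw [map_pow, hQfac, mul_pow, ← pow_mul, Finset.prod_mul_distrib, Finset.prod_pow_eq_pow_sum]
    simp_rw [mul_comm (a _) (m _)]
    ring
  have hTU : constantCoeff (T U) ≠ 0 := by rw [hTc]; exact hU
  have hndvd' : ¬ (X 0 : MvPowerSeries (Fin (n + 1)) k) ∣ T U * ∏ i, g i ^ m i := by
    intro hdvd
    rcases hprime.dvd_or_dvd hdvd with hU' | hP
    · have := isUnit_iff_constantCoeff.mpr (isUnit_iff_ne_zero.mpr hTU)
      exact hprime.not_unit (isUnit_of_dvd_unit hU' this)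
    · obtain ⟨i, -, hi⟩ := (Prime.dvd_finsetProd_iff hprime _).mp hP
      exact hgndvd i (hprime.dvd_of_dvd_pow hi)
  obtain ⟨-, hgg⟩ := X_pow_mul_eq_X_pow_mul 0 (hfac.symm.trans hG) hndvd hndvd'
  -- the transform of `F = ∏ Q`
  have hF' : subst (cruxChart k w c) (subst θ F) = X 0 ^ (∑ i, a i) * ∏ i, g i := by
    rw [hT, hFQ, map_prod]
    simp_rw [hQfac, Finset.prod_mul_distrib, Finset.prod_pow_eq_pow_sum]
  have hndvd₀ : ¬ (X 0 : MvPowerSeries (Fin (n + 1)) k) ∣ ∏ i, g i := by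
    intro hP
    obtain ⟨i, -, hi⟩ := (Prime.dvd_finsetProd_iff hprime _).mp hP
    exact hgndvd i hi
  rw [hgg]
  by_cases hsing₀ : constantCoeff (∏ i, g i) = 0 ∧ ∀ j, coeff (Finsupp.single j 1) (∏ i, g i) = 0
  · -- `∏ g` is a singular successor of `F`: induction hypothesis
    exact ih _ ⟨c, _, hc, hF', hndvd₀, hsing₀⟩ g m (T U) hm1 hTU rfl
  · -- `∏ g` is not singular
    by_cases h0 : constantCoeff (∏ i, g i) = 0
    · -- order one: exactly one factor in `𝔪`, and it is smooth
      have hlin : ∃ j, coeff (Finsupp.single j 1) (∏ i, g i) ≠ 0 := by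
        by_contra hcon
        push Not at hcon
        exact hsing₀ ⟨h0, hcon⟩
      rw [map_prod, Finset.prod_eq_zero_iff] at h0
      obtain ⟨i₀, -, hi₀⟩ := h0
      have hothers : ∀ i, i ≠ i₀ → constantCoeff (g i) ≠ 0 := by
        intro i hi hgi
        obtain ⟨j, hj⟩ := hlin
        exact hj (coeff_single_one_prod_eq_zero g hi hgi hi₀ j)
      have hlin₀ : ∃ j, coeff (Finsupp.single j 1) (g i₀) ≠ 0 := by
        by_contra hcon
        push Not at hcon
        obtain ⟨j, hj⟩ := hlin
        apply hj
        apply coeff_of_lt_order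
        rw [Finsupp.degree_single, ← Finset.mul_prod_erase _ _ (Finset.mem_univ i₀)]
        have h2 : ((2 : ℕ) : ℕ∞) ≤ (g i₀).order := nat_le_order fun β hβ => by
          rcases FormalCoordChange.eq_zero_or_single_of_degree_lt_two β hβ with hβ0 | ⟨j', rfl⟩
          · rw [hβ0, coeff_zero_eq_constantCoeff]; exact hi₀
          · exact hcon j'
        calc ((1 : ℕ) : ℕ∞) < 2 := by norm_num
          _ ≤ (g i₀).order := h2
          _ ≤ (g i₀).order + ((Finset.univ.erase i₀).prod g).order := le_self_add
          _ ≤ _ := le_order_mul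
      rw [← Finset.mul_prod_erase _ _ (Finset.mem_univ i₀), mul_comm (g i₀ ^ m i₀), ← mul_assoc]
      refine won_unit_mul_pow_of_linear (g i₀) _ hi₀ hlin₀ ?_ (m i₀)
      rw [map_mul, map_prod]
      refine mul_ne_zero hTU (Finset.prod_ne_zero_iff.mpr fun i hi => ?_)
      rw [map_pow]
      exact pow_ne_zero _ (hothers i (Finset.ne_of_mem_erase hi))
    · -- `∏ g` is a unit: then `g'` would be a unit, but it is singular
      exfalso
      apply (show constantCoeff (T U * ∏ i, g i ^ m i) ≠ 0 from ?_) (by rw [← hgg]; exact hsing.1)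
      rw [map_mul, map_prod]
      refine mul_ne_zero hTU (Finset.prod_ne_zero_iff.mpr fun i _ => ?_)
      rw [map_pow]
      refine pow_ne_zero _ fun hgi => h0 ?_
      rw [map_prod]
      exact Finset.prod_eq_zero (Finset.mem_univ i) hgi

end WonMultiplicity

end Summit.ResolutionOfSingularities.ResolutionOfSingularities.Theorems
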